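import Summits.Schanuel.Schanuel.Theorems.RootDecomp1KDegreeLadder08
import Literature.NumberTheory.DiophantineApproximation.RidoutIntegers

/-!
# RootDecomp1KDegreeLadder — lens 1, generation 45 «DEGREE LADDER AT FIXED SKEL-QUALITY (DL) + THIN-FIBRE RESIDUAL» (lane K-R30 (b); CLAIM L2155, ACK/CHECKLIST K-g45 L2159, NODE L2213 / REQUEST L2214, writer re-checks L2219/L2221/L2230, critic VERDICT L2216: CLEARED — THEOREM ×1 for DL `degreeLadder`; EDITION 2/3 docstring-only accepted L2224 / files of record L2228 (K ed. 3 f2af863f…); RULE K-R31; lens-1 tally credits ×11 + THEOREM ×2) — continuation (RootDecomp1KDegreeLadder09): §8b the printed leaf instance decided HYPOTHESIS-FREE (Ridout by tree name)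

(lens-1 g45 HOME kernel K = HOME/decomp-schanuel-lens-1/g45/DegreeLadder.lean EDITION 3 f2af863f…, 2183 l, imports tree `…RootDecomp1KSkelCell01` (the tree now has `…SkelCell10` with §8's `SkelLiouvilleFix`); P DLprobe.lean f44a49e4… rc 0, C DLctrl.lean 394594cd… rc 1 = exactly the 13 planted errors. Port by census-1 gen 19 as `RootDecomp1KDegreeLadder01`–`08` (+ `09` deferred): 01 = K's module doc + §0 residue (`skelLiouvilleFix_of_skelLiouville`, `SkelLiouvilleFix.liouville` / `.transcendental` declared in the TREE namespace `…RootDecomp1KSkelCell` so dot-notation keeps working) + §1 toolkit `bev`/`xdeg`/`dX`/`specX`; 02 = §2 truncations + §3 calculus (`tangent`, Lipschitz, `coeff_specX_bound`); 03 = §4 engine A (`onCurve_exponent_ineq`, `engine_core`); 04 = §4 engine B (`lowDegree_clause`, `engine_of_clause`, `engine`) + §5 THE DEGREE LADDER `degreeLadder (d) (ρ) (hρ : SkelLiouvilleFix (d + 1) ρ) (P : ℤ[X][X]) (hP : P ≠ 0) (hdeg : P.natDegree ≤ d) : bev P (liouvilleNumber 2) ρ ≠ 0` (descent `no_relation_of_engine`);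 05 = §5b limit corollary (`algebraicIndependent_of_forall_fix`) + §5c relative degree (`relDegree_gt`, `skelFix_two_not_mem_adjoin(_complex)`); 06 = §5d the residual `ThinFibre`/`ThinFibreAt` (+ glue `thinFibre_imp_b`) + §6 the toy fibre decided (`sq_fibre_iff`, `toy_clause`); 07 = §7 tightness at d = 1 (`degreeLadder_tight_one`, `rU_injective`, `not_thinFibre_one`, `not_thinFibre_zero`); 08 = §8a the 2-adic mechanism (`two_adic_split`, `two_adic_quality`, hypothesis-free); 09 (DEFERRED until Literature `…DiophantineApproximation.RidoutIntegers` builds on the check farm, rc 75 today) = §8b `isSquare_mul_psNumer_finite`, `isSquare_seventeen_mul_psNumer_finite`, `thinFibreAt_sqMulP` with `Ridout.padicRoth_int` BY NAME (K carries them under a `(hR : PadicRothInt)` binder whose `def` is NOT landed — verdict condition (c)).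
PORT EDITS (part 09): the three §8b theorems of K carried `(hR : PadicRothInt)`; here the binder is REMOVED and the tree's PROVED `Literature.NumberTheory.DiophantineApproximation.Ridout.padicRoth_int` is applied BY NAME (VERDICT L2216 (c): no vendored `def PadicRothInt`; hyp-free corollary welcome); proofs otherwise verbatim. `--supports stmt-Schanuel-33364`; no census credit; rung 0.)
-/

noncomputable section

open Polynomial LiouvilleNumber
open scoped Nat

namespace Summit.Schanuel.Schanuel.Theorems.RootDecomp1KDegreeLadder

open Summit.Schanuel.Schanuel.Theorems.RootDecomp1KSkelCell
  (exists_le_two_pow_factorial iota iota_spec iota_le_of_le pow_lt_of_lt_iota lt_iota_of_pow_lt iota_mono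
   one_le_iota SkelLiouville SkelLiouvilleFix skelLiouville_iff_fix SkelLiouvilleFix.mono uStar dU rU dU_cast
   two_pow_le_four_mul_dU two_mul_dU_lt one_le_dU rU_den rU_cast uStar_sub_rU skelLiouvilleFix_one_uStar
   not_skelFixOne_algebraicIndependent)
open Summit.Schanuel.Schanuel.Theorems.RootDecomp1KTwoBaseCell (psNumer partialSum_eq_psNumer_div coprime_psNumer
  algebraicIndependent_of_forall_int')
open Summit.Schanuel.Schanuel.Theorems.RootDecomp1KRelLiouvilleCell (partialSum_two_strictMono
  partialSum_two_lt_liouvilleNumber abs_liouvilleNumber_two_sub_partialSum)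

section Ridout

/-- `s_N = p_N / 2^{N!}` (tree `partialSum_eq_psNumer_div` at `b = 2`). -/
private theorem partialSum_two (N : ℕ) : partialSum 2 N = (psNumer 2 N : ℝ) / (2 : ℝ) ^ N ! := by
  have := partialSum_eq_psNumer_div (b := 2) (by norm_num) N
  simpa using this

/-- `0 < p_N`. -/
private theorem psNumer_pos (N : ℕ) : 0 < psNumer 2 N := by
  unfold psNumer
  exact Finset.sum_pos (fun i _ => pow_pos two_pos _) (Finset.nonempty_range_iff.mpr (Nat.succ_ne_zero N))

/-- `N ↦ p_N` is strictly increasing. -/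
private theorem psNumer_two_strictMono : StrictMono (psNumer 2) := by
  refine strictMono_nat_of_lt_succ fun M => ?_
  rw [psNumer_succ']
  have h1 : 1 ≤ 2 ^ (M * M !) := Nat.one_le_two_pow
  have h2 := psNumer_pos M
  nlinarith

/-- **THE PRINTED LEAF INSTANCE, DECIDED (by Ridout 1958 = the tree's `padicRoth_int`, HYPOTHESIS-FREE: Ridout BY TREE NAME — census port part 09, VERDICT L2216 (c)).**
For every odd `c`, `c·psNumer 2 N` is a perfect square for only finitely many `N`; with `c = 17` this is the
statement «`17·p_N = □` finitely often» printed in the `ThinFibre` docstring as the first sporadic-point question.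
(Ineffective: the exceptional set is finite but not bounded by this proof.) -/
theorem isSquare_mul_psNumer_finite {c : ℕ} (hc : Odd c) :
    {N : ℕ | IsSquare (c * psNumer 2 N)}.Finite := by
  classical
  -- square roots of `c` in every `\overline{ℚ_p}`, algebraic over `ℚ`
  have hex : ∀ p : Nat.Primes, ∃ z : @PadicAlgCl (p : ℕ) ⟨p.2⟩, z ^ 2 = ((c : ℕ) : @PadicAlgCl (p : ℕ) ⟨p.2⟩) :=
    fun p => by
      haveI : Fact (p : ℕ).Prime := ⟨p.2⟩
      exact IsAlgClosed.exists_pow_nat_eq _ two_pos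
  choose α hα using hex
  have hαalg : ∀ p ∈ ({pTwo} : Finset Nat.Primes), IsAlgebraic ℚ (α p) := fun p _ => by
    haveI : Fact (p : ℕ).Prime := ⟨p.2⟩
    refine ⟨X ^ 2 - C (c : ℚ), X_pow_sub_C_ne_zero two_pos _, ?_⟩
    simp [hα p]
  have hαalg' : ∀ p ∈ ({pTwo} : Finset Nat.Primes), IsAlgebraic ℚ (-α p) := fun p hp => (hαalg p hp).neg
  have hε : (0 : ℝ) < 1 / 2 := by norm_num
  have hF₁ := Literature.NumberTheory.DiophantineApproximation.Ridout.padicRoth_int {pTwo} α hαalg hε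
  have hF₂ := Literature.NumberTheory.DiophantineApproximation.Ridout.padicRoth_int {pTwo} (fun p => -α p) hαalg' hε
  have hc0 : 0 < c := hc.pos
  -- the tail `N ≥ 3c + 6` injects into the two finite exceptional sets via `N ↦ √(c·p_N)`
  set f : ℕ → ℤ := fun N => ((Nat.sqrt (c * psNumer 2 N) : ℕ) : ℤ) with hf
  have hfval : ∀ {N m : ℕ}, c * psNumer 2 N = m * m → f N = m := by
    intro N m hm
    show ((Nat.sqrt (c * psNumer 2 N) : ℕ) : ℤ) = m
    rw [hm, Nat.sqrt_eq]
  have htail : ({N : ℕ | IsSquare (c * psNumer 2 N)} ∩ {N | 3 * c + 6 ≤ N}).Finite := by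
    refine Set.Finite.of_finite_image (f := f) ((hF₁.union hF₂).subset ?_) ?_
    · rintro _ ⟨N, ⟨⟨⟨m, hm⟩, hN⟩, rfl⟩⟩
      have hN' : 3 * c + 6 ≤ N := hN
      obtain ⟨M, rfl⟩ : ∃ M, N = M + 1 := ⟨N - 1, by omega⟩
      have hM : 3 * c + 5 ≤ M := by omega
      have hM2 : 2 ≤ M := by omega
      have hy : (m : ℤ) ^ 2 = c * psNumer 2 (M + 1) := by rw [sq]; exact_mod_cast hm.symm
      have hq := two_adic_quality hc hM hy
      rw [hfval hm]
      rcases two_adic_split hc (α pTwo) (hα pTwo) hM2 hy with h | h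
      · left
        show (∏ p ∈ ({pTwo} : Finset Nat.Primes), min (1 : ℝ) ‖((m : ℤ) : @PadicAlgCl (p : ℕ) ⟨p.2⟩) - α p‖) <
          |((m : ℤ) : ℝ)| ^ (-(1 + 1 / 2 : ℝ))
        rw [Finset.prod_singleton]
        calc min (1 : ℝ) ‖((m : ℤ) : PadicAlgCl 2) - α pTwo‖ ≤ ‖((m : ℤ) : PadicAlgCl 2) - α pTwo‖ :=
              min_le_right _ _
          _ ≤ 2 * (1 / 2 : ℝ) ^ (M * M !) := h
          _ < |((m : ℤ) : ℝ)| ^ (-(1 + 1 / 2 : ℝ)) := hq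
      · right
        show (∏ p ∈ ({pTwo} : Finset Nat.Primes), min (1 : ℝ) ‖((m : ℤ) : @PadicAlgCl (p : ℕ) ⟨p.2⟩) - -α p‖) <
          |((m : ℤ) : ℝ)| ^ (-(1 + 1 / 2 : ℝ))
        rw [Finset.prod_singleton, sub_neg_eq_add]
        calc min (1 : ℝ) ‖((m : ℤ) : PadicAlgCl 2) + α pTwo‖ ≤ ‖((m : ℤ) : PadicAlgCl 2) + α pTwo‖ :=
              min_le_right _ _
          _ ≤ 2 * (1 / 2 : ℝ) ^ (M * M !) := h
          _ < |((m : ℤ) : ℝ)| ^ (-(1 + 1 / 2 : ℝ)) := hq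
    · rintro N ⟨⟨m, hm⟩, -⟩ N' ⟨⟨m', hm'⟩, -⟩ hff
      have h1 : f N = m := hfval hm
      have h2 : f N' = m' := hfval hm'
      have hmm : m = m' := by have := h1.symm.trans (hff.trans h2); exact_mod_cast this
      have : c * psNumer 2 N = c * psNumer 2 N' := by rw [hm, hm', hmm]
      exact psNumer_two_strictMono.injective (Nat.eq_of_mul_eq_mul_left hc0 this)
  refine ((Set.finite_lt_nat (3 * c + 6)).union htail).subset ?_
  intro N hN
  by_cases h : N < 3 * c + 6
  · exact Or.inl h
  · exact Or.inr ⟨hN, not_lt.mp h⟩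

/-- The instance of the `ThinFibre` docstring verbatim: `17·p_N` is a square for only finitely many `N`. -/
theorem isSquare_seventeen_mul_psNumer_finite : {N : ℕ | IsSquare (17 * psNumer 2 N)}.Finite :=
  isSquare_mul_psNumer_finite (by decide)

/-- **The conics `Y² = c·x` (`c` odd — e.g. the critic's `Y² = 17x`) satisfy the clause of `ThinFibre m₀` at
EVERY quality `m₀`**: beyond the (finite, ineffective) set of levels where `c·p_N` is a square they carry no
rational point at all (a point `r` above level `N ≥ 2` gives `(r·2^{N!/2})² = c·p_N`). -/
theorem thinFibreAt_sqMulP {c : ℕ} (hc : Odd c) (m₀ : ℕ) : ThinFibreAt m₀ (sqMulP c) := by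
  classical
  obtain ⟨N₀, hN₀⟩ : ∃ N₀ : ℕ, ∀ N, N₀ ≤ N → ¬ IsSquare (c * psNumer 2 N) := by
    obtain ⟨B, hB⟩ := (isSquare_mul_psNumer_finite hc).bddAbove
    exact ⟨B + 1, fun N hN hsq => by have := hB hsq; omega⟩
  intro C₀
  refine ⟨max N₀ 2, fun N hN r _ hr _ => ?_⟩
  exfalso
  have hN0 : N₀ ≤ N := le_of_max_le_left hN
  have hN2 : 2 ≤ N := le_of_max_le_right hN
  apply hN₀ N hN0
  rw [bev_sqMulP, sub_eq_zero, partialSum_two] at hr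
  have hQ : (r : ℚ) ^ 2 = c * ((psNumer 2 N : ℚ) / 2 ^ N !) := by
    have : ((r ^ 2 : ℚ) : ℝ) = ((c * ((psNumer 2 N : ℚ) / 2 ^ N !) : ℚ) : ℝ) := by
      push_cast; exact hr
    exact_mod_cast this
  obtain ⟨k, hk⟩ := Nat.dvd_factorial two_pos hN2
  have hsq : IsSquare (((c * psNumer 2 N : ℕ)) : ℚ) := by
    refine ⟨r * 2 ^ k, ?_⟩
    have hne : (2 : ℚ) ^ N ! ≠ 0 := pow_ne_zero _ two_ne_zero
    have h2k : (2 : ℚ) ^ N ! = 2 ^ k * 2 ^ k := by rw [hk, two_mul, pow_add]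
    have e1 : ((c * psNumer 2 N : ℕ) : ℚ) = r ^ 2 * 2 ^ N ! := by
      rw [hQ]; push_cast; field_simp
    rw [e1, h2k]; ring
  exact Rat.isSquare_natCast_iff.mp hsq

end Ridout

end Summit.Schanuel.Schanuel.Theorems.RootDecomp1KDegreeLadder

end
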